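import Mathlib
import HarnessLib
import Summits.HubbardSuperconductivity.HubbardSuperconductivity.Theorems.KLProgrammeKLRegimeSplitCounterMap

/-!
# Route `KLProgramme` — child 2 (`CountertermP2 klPredsV7 klWindowC`) groundwork: a frame ASSEMBLED FROM CERTIFIED PIECES is admissible
# (`FrameGeometry` / `GeomConstants` / `FrameOK` from per-piece derivative bounds) — the STAGE SCHEME's self-map half
# (crux K3 `KLRegimeTwoPointLimit`, stmt-HubbardSuperconductivity-19937; seat p2, g4)

Why this abstraction (p2 g4 NOTES «child-2 proof architecture»; plan g10 rulings Δ11′/Δ13/Δ14).  In the V7 bundle the two-leg sizes are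
TWO-TIER (`TwoLegSizesG`: orders `≤ 4` only for frames without structure finer than the scale), so child 2 cannot re-certify the coarse
pieces of a DEEP frame; it builds its frame ONCE, scale by scale, with FROZEN coarse pieces — `K^{(n)} = K^{(n-1)} + δ_n`, `δ_n` the
stage-`n` fixed point certified `C⁴` at stage `n` — and never re-evaluates them.  What the self-map step then needs is not
`frameGeometry_counterterm` (which is tied to the wholesale map `K ⊖ D_N(K)` and to the v1 pieces) but its ABSTRACT core: a frame whose
NEGATIVE is a finite sum of pieces `Kp n`, each with derivative bounds `bd j n`, has `FrameGeometry` with the summed bounds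
(`frameGeometry_of_pieces`), hence `GeomConstants` on the covariance window when the sums are small (`geomConstants_of_pieces`), and IS
`FrameOK R U N μ` when moreover the per-piece bounds sit under the renormalisation package's allowances (`frameOK_of_pieces`).  Proofs only
(the pattern of `KLProgrammeKLRegimeSplitCounterMap`, abstracted); nothing is asserted about the model.
-/

noncomputable section

namespace Summit.HubbardSuperconductivity.HubbardSuperconductivity.Theorems.KLRegimeSplit

set_option linter.dupNamespace false -- summit = problem name (single-conjunct summit), D-0017

open Real Finset Literature.MathematicalPhysics.QuantumLattice Literature.Probability.LatticeModels
open Literature.MathematicalPhysics.QuantumLattice.FermiRG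
open Summit.HubbardSuperconductivity.HubbardSuperconductivity.Theorems.DispersionFlow

/-- **A frame assembled from pieces has the summed geometry**: if `frameShift K = Σ_{n ≤ N} evalM (Kp n)` (i.e. `K = -Σ Kp n` as a
function) and every piece obeys `‖Dʲ (evalM (Kp n))‖ ≤ bd j n` for `j ≤ 2` with `bd ≥ 0`, then `K` satisfies `FrameGeometry` with
`a₀ = Σ_n bd 0 n`, `a₁ = Σ_n bd 1 n`, `A = b = Σ_n Σ_{j<3} bd j n`, on any tube `ē`. -/
theorem frameGeometry_of_pieces {K : TrigPolyC4v} {Kp : ℕ → TrigPolyC4v} {N : ℕ} {bd : ℕ → ℕ → ℝ} {μ : ℝ}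
    (hbd : ∀ j n, 0 ≤ bd j n)
    (hsum : frameShift K = fun q => ∑ n ∈ range (N + 1), evalM (Kp n) q)
    (hS : ∀ n ≤ N, ∀ j ≤ 2, ∀ q : Momentum, ‖iteratedFDeriv ℝ j (evalM (Kp n)) q‖ ≤ bd j n) (ebar : ℝ) :
    FrameGeometry (∑ n ∈ range (N + 1), bd 0 n) (∑ n ∈ range (N + 1), bd 1 n)
      (∑ n ∈ range (N + 1), ∑ j ∈ range 3, bd j n) (∑ n ∈ range (N + 1), ∑ j ∈ range 3, bd j n) ebar μ K := by
  have hC : ∀ n, ContDiff ℝ 2 (evalM (Kp n)) := fun n => contDiff_evalM _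
  have hD : ∀ j ≤ 2, ∀ q : Momentum,
      ‖iteratedFDeriv ℝ j (frameShift K) q‖ ≤ ∑ n ∈ range (N + 1), bd j n := by
    intro j hj q
    rw [hsum, iteratedFDeriv_fun_sum_apply fun n _ => (contDiff_evalM _).contDiffAt]
    refine (norm_sum_le _ _).trans (sum_le_sum fun n hn => ?_)
    exact hS n (Nat.lt_succ_iff.mp (mem_range.mp hn)) j hj q
  have hsingle : ∀ j < 3, ∑ n ∈ range (N + 1), bd j n ≤ ∑ n ∈ range (N + 1), ∑ j ∈ range 3, bd j n := fun j hj =>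
    sum_le_sum fun n _ => single_le_sum (f := fun j => bd j n) (fun i _ => hbd i n) (mem_range.mpr hj)
  refine ⟨?_, ?_, ?_, ?_, ?_⟩
  · rw [hsum]; exact ContDiff.sum fun n _ => hC n
  · intro p
    have h := hD 0 (by norm_num) p
    rwa [norm_iteratedFDeriv_zero, Real.norm_eq_abs] at h
  · intro p
    have h := hD 1 (by norm_num) p
    rwa [norm_iteratedFDeriv_one] at h
  · intro p j hj
    exact (hD j hj p).trans (hsingle j (by omega))
  · intro p _ t _
    have h2 := (hD 2 le_rfl p).trans (hsingle 2 (by norm_num))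
    have hq := abs_fderiv_fderiv_le (frameShift K) p t t
    rw [← hessQuad_eq_fderiv_fderiv] at hq
    have ht : 0 ≤ ‖t‖ * ‖t‖ := by positivity
    have := (abs_le.mp (hq.trans (by nlinarith [h2, ht] :
      ‖iteratedFDeriv ℝ 2 (frameShift K) p‖ * ‖t‖ * ‖t‖ ≤
        (∑ n ∈ range (N + 1), ∑ j ∈ range 3, bd j n) * ‖t‖ ^ 2))).1
    linarith

/-- **… hence `GeomConstants` on the covariance window** when the summed piece bounds are small
(`Σ bd 0 ≤ 3/80`, `Σ bd 1 ≤ 1/2000`, `Σ Σ_{j<3} bd ≤ 1/100`). -/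
theorem geomConstants_of_pieces {K : TrigPolyC4v} {Kp : ℕ → TrigPolyC4v} {N : ℕ} {bd : ℕ → ℕ → ℝ} {μ : ℝ}
    (hμ : μ ∈ Set.Icc (-1.05 : ℝ) (-0.15)) (hbd : ∀ j n, 0 ≤ bd j n)
    (hsum : frameShift K = fun q => ∑ n ∈ range (N + 1), evalM (Kp n) q)
    (hS : ∀ n ≤ N, ∀ j ≤ 2, ∀ q : Momentum, ‖iteratedFDeriv ℝ j (evalM (Kp n)) q‖ ≤ bd j n)
    (h0 : ∑ n ∈ range (N + 1), bd 0 n ≤ 3 / 80) (h1 : ∑ n ∈ range (N + 1), bd 1 n ≤ 1 / 2000)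
    (h2 : ∑ n ∈ range (N + 1), ∑ j ∈ range 3, bd j n ≤ 1 / 100) :
    GeomConstants (frameLevel μ K) 7 (3 / 80) (1 / 2) (3 / 200) :=
  geomConstants_frameLevel_covWindow hμ (frameGeometry_of_pieces hbd hsum hS (3 / 40)) le_rfl h0
    (sum_nonneg fun n _ => hbd 1 n) h1 (h2.trans (by norm_num)) h2

/-- **A frame assembled from certified pieces IS admissible** (`FrameOK R U N μ K`): on the covariance window, if `K = -Σ_{n ≤ N} Kp n`
(as functions on `Fin 2 → ℝ`), the pieces obey the ALLOWANCES `‖Dʲ (evalM (Kp n))‖ ≤ R.Gfr j · uPow j U · 4^{(j-2)n}` for `j ≤ 4`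
(what the stage scheme certifies once per stage from `TwoLegSizesG`'s second tier), and the orders `≤ 2` of those allowances sum small,
then `K` is in `FrameOK` with the pieces `0 ⊖ Kp n`. -/
theorem frameOK_of_pieces {R : RenConsts} (hR : ∀ j, 0 ≤ R.Gfr j) {U μ : ℝ} {K : TrigPolyC4v} {Kp : ℕ → TrigPolyC4v} {N : ℕ}
    (hμ : μ ∈ Set.Icc (-1.05 : ℝ) (-0.15))
    (hsumE : ∀ p : Fin 2 → ℝ, K.eval p = ∑ n ∈ range (N + 1), (fsub 0 (Kp n)).eval p)
    (hS : ∀ n ≤ N, ∀ j ≤ 4, ∀ q : Momentum,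
      ‖iteratedFDeriv ℝ j (evalM (Kp n)) q‖ ≤ R.Gfr j * uPow j U * (4 : ℝ) ^ (((j : ℤ) - 2) * n))
    (h0 : ∑ n ∈ range (N + 1), R.Gfr 0 * uPow 0 U * (4 : ℝ) ^ (((0 : ℤ) - 2) * n) ≤ 3 / 80)
    (h1 : ∑ n ∈ range (N + 1), R.Gfr 1 * uPow 1 U * (4 : ℝ) ^ (((1 : ℤ) - 2) * n) ≤ 1 / 2000)
    (h2 : ∑ n ∈ range (N + 1), ∑ j ∈ range 3, R.Gfr j * uPow j U * (4 : ℝ) ^ (((j : ℤ) - 2) * n) ≤ 1 / 100) :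
    FrameOK R U N μ K := by
  set bd : ℕ → ℕ → ℝ := fun j n => R.Gfr j * uPow j U * (4 : ℝ) ^ (((j : ℤ) - 2) * n) with hbd_def
  have hbd : ∀ j n, 0 ≤ bd j n := fun j n =>
    mul_nonneg (mul_nonneg (hR j) (uPow_nonneg j U)) (zpow_nonneg (by norm_num) _)
  -- the shift of `K` is the sum of the pieces
  have hsum : frameShift K = fun q => ∑ n ∈ range (N + 1), evalM (Kp n) q := by
    funext q
    show -evalM K q = _
    rw [evalM_apply, hsumE]
    simp only [eval_fsub, TrigPolyC4v.eval_zero, zero_sub, sum_neg_distrib, neg_neg]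
    rfl
  refine ⟨geomConstants_of_pieces hμ hbd hsum (fun n hn j hj q => hS n hn j (hj.trans (by norm_num)) q) h0 h1 h2,
    fun n => fsub 0 (Kp n), hsumE, fun n hn j hj q => ?_⟩
  rw [evalM_fsub_zero, iteratedFDeriv_neg_apply, norm_neg]
  exact hS n hn j hj q

end Summit.HubbardSuperconductivity.HubbardSuperconductivity.Theorems.KLRegimeSplit

end
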